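import Literature.NumberTheory.EllipticCurves.YanZhu2026.GreenbergMainTheorems
import Literature.NumberTheory.EllipticCurves.BurungaleSkinnerTianWan2024.GreenbergMainStatementOPEN
import Literature.NumberTheory.EllipticCurves.Tian2014.CongruentNumbersHeegnerPoints
import Mathlib.NumberTheory.Cyclotomic.Basic
import HarnessLib

/-!
# Burungale–Castella–Skinner 2025, Corollary 4.1.4 and Proposition 5.2.1 — the two-variable PRODUCT
# divisibilities for a pair of elliptic newforms (`g`, `g′`), resp. (`g`, `g_F`) from base change

Source: A. Burungale, F. Castella, C. Skinner, *Base change and Iwasawa main conjectures for GL₂*,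
IMRN 2025 no. 8, rnaf082 = arXiv:2405.00270v2 (REFEREED; bib key `BurungaleCastellaSkinner2025`),
§4.1 Cor. 4.1.4 (p. 8, `[corpus: paper:arxiv-2405.00270 p0008 L52–L72]`) and §5.2 Prop. 5.2.1
(pp. 9–10, `[p0009 L75–L83]`, `[p0010 L1–L55]`).  Cell `pub/bsd-littype` (literature-typing layer,
D-0088(4)), seat `bsd-littype-03` (gen 4), sheet `staging/bsd-littype-03/SHEETS-03.md` §7 — the last
two typable numbered items of the paper (§1 rows 22b, 28), now that the two-variable carriers exist:
`WeierstrassCurve.XOrd₂ / XGr₂` (`TwoVariableSelmerDual.lean`, this seat gen 0), the type-I frame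
`IsHidaRankinLFunction` / `perrinRiouLFunction` / `IdealLeSpan(Away)` (`YanZhu2026/TwoVariableMainTheorems.lean`)
and the SOUND Greenberg value frame `IsGreenbergLFunctionAnyRoot₂`
(`BurungaleSkinnerTianWan2024/GreenbergMainStatementOPEN.lean`: Yan–Zhu Def. 3.11 with `L(f/K, ξ, 1)`
read through an entire continuation of the Euler product and no unit-root clause) over a Katz frame
`IsKatzMeasure₂` read at the inverse generators (orientation (O1)–(O4) of
`Rubin1991/TwoVariableMainConjecture.lean`, kept by that frame).  The one-form equivalence Thm. 4.1.3 is the tree's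
`YanZhu2026.thm47_ord_localised_iff_greenberg_localised` (cited, not restated).

## The printed statements (verbatim)

> **Corollary 4.1.4.** Let `g ∈ S₂(Γ₀(N))` and `g′ ∈ S₂(Γ₀(N′))` be newforms, `p ∤ 2NN′` an ordinary
> prime for both `g` and `g′`, and `K` an imaginary quadratic field satisfying (spl) and
> `(D_K, NN′) = 1`, and such that (irr_K) holds for both `g` and `g′`. Then the following are
> equivalent: (i) `(L_p^PR(g/K) · L_p^PR(g′/K)) ⊃ ch_{Λ_K}(X_ord(g/K_∞)) · ch_{Λ_K}(X_ord(g′/K_∞))`.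
> (ii) `(L_p^Gr(g/K) · L_p^Gr(g′/K)) ⊃ ch_{Λ_K}(X_Gr(g/K_∞)) · ch_{Λ_K}(X_Gr(g′/K_∞))`.
> Moreover, the same holds for the opposite divisibility.
> [Proof: "Taking the direct sum of two pairs of four-term exact sequences as in the proof of
> Theorem 4.1.3", i.e. [BSTW23, §9.3.2], Poitou–Tate.]

> **Proposition 5.2.1.** Let `g ∈ S₂(Γ₀(N))` be an elliptic newform and `p ≥ 5` a prime of good
> ordinary reduction for `g`. Let `K` be an imaginary quadratic field satisfying (disc), (Heeg),
> (spl), and (irr_K). Suppose `F` is a real quadratic field of discriminant `D_F` satisfying the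
> following hypotheses: (i) `p` is inert in `F`. (ii) `D_F` is odd and every prime dividing `D_F`
> splits in `K`. (iii) Every prime `ℓ ∣ N` is inert in `F` if `ℓ ≡ −1 (mod p)`, and is split in `F`
> otherwise. (iv) (irr_M) holds for `M = FK`. (v) `ρ̄_g|_{G_{F(ζ_p)}}` is irreducible. (vi) If `p = 5`,
> then `F ≠ ℚ(ζ₅)⁺`. Then we have the divisibilities
> `(L_p^PR(g/K) · L_p^PR(g_F/K)) ⊃ ch_{Λ_K}(X_ord(g/K_∞)) · ch_{Λ_K}(X_ord(g_F/K_∞))` in `Λ_K`, and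
> `(L_p^Gr(g/K) · L_p^Gr(g_F/K)) ⊃ ch_{Λ_K}(X_Gr(g/K_∞)) · ch_{Λ_K}(X_Gr(g_F/K_∞))` in `Λ_K^ur`.
> [`g_F` = "the twist of `g` by the quadratic character corresponding to `F/ℚ`" (Lemma 5.1.1);
> proof via Wan's divisibility over `M = FK` (Thm. 3.2.1), Lemmas 5.1.1–5.1.2, Cor. 4.1.4 and
> Prop. 4.2.2 — Hilbert modular forms, not in the tree.]

## Transcription (tree vocabulary only; every carrier cited by name, none re-declared)

Both statements are typed for the newforms of ELLIPTIC CURVES over `ℚ` (`g = f_E`, `g′ = f_{E′}`;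
Cor. 4.1.4 prints arbitrary weight-two newforms — WEAKER, special case), in the common currency of the
two sides: `E = W`, `E′ = W′` globally minimal with modular parametrisations `π : ModularParametrizationData W N`,
`π′` (levels `N = N_E`, `N′ = N_{E′}` through `GreenbergSetting.level`); `K` with `(p) = v v̄`, `v`
induced by the embedding datum `ι : ℚ̄_p ≃ ℂ` (Katz/Greenberg frames) and `ι₁ : ℤ̄ → ℂ_p` compatible
with `ι` (type-I frames), as in `thm47_…`; `Γ_K` through THE (cyclotomic, anticyclotomic) pair
`(κ₁, κ₂)` with an adapted generator pair `(γ₁, γ₂)`; ALL the standing data of both curves packaged as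
`YanZhu2026.GreenbergSetting ι W N K v v̄ κ₁ κ₂` and `… W′ N′ …` (so: `p > 2` good ORDINARY for both,
`K` imaginary quadratic, (spl), `(N, D_K) = (N′, D_K) = 1` — i.e. `(D_K, NN′) = 1` —, and ALSO (disc):
`D_K` odd, `≠ −3`, which Cor. 4.1.4 does not print (WEAKER) and Prop. 5.2.1 does); (irr_K) =
`(W.baseChange K).HasIrreducibleModPGaloisRep p`.  `L_p^PR(g/K) = perrinRiouLFunction W π F` for a
type-I frame `F` (`IsHidaRankinLFunction ι₁ W κ₁ κ₂ π.f F ∧ IsCongruenceIntegral π.f F`); `L_p^Gr(g/K) = G`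
with `IsGreenbergLFunctionAnyRoot₂ ι v v̄ κ₁ κ₂ γ₁⁻¹ γ₂⁻¹ π.f |D_K| h_K LK G` over ONE Katz frame `LK`
(`𝓛_𝔭(K)` depends on `K` only) shared by `G` and `G′`; products of ideals are products in
`IwasawaAlgebra₂ p`, resp. of the extended ideals `charIdeal.map (toUnr₂ p J)` in `𝒪_{ℂ_p}⟦T₁⟧⟦T₂⟧`
along a structure-compatible `J`; "`⊃` in `Λ_K` / `Λ_K ⊗ ℚ_p`" and "in `Λ_K^ur` / `Λ_K^ur ⊗ ℚ_p`" in the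
`S = {sⁿ}` one-generator currency of `thm47_…` (`IdealLeSpanAway s`, `SpanLeIdealAway s`; `s = 1`
integral, `s = p` rational).  Cor. 4.1.4 does not print in which ring its inclusions are meant; it is
typed, like Thm. 4.1.3 (= YZ Thm. 4.7), for every `s ≠ 0` (both "in `⊗ ℚ_p`" and "before inverting
`p`"), which is how Prop. 5.2.1's proof uses it (p. 10: rationally for (5.1), then integrally).

Prop. 5.2.1's field `F` enters the CONCLUSION only through `g_F`: typed as `W′` = a globally minimal
model of the quadratic twist `W^{(d_F)}` (`∃ C, C • W′ = W.quadraticTwist d_F`, the shape of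
`CyclotomicIwasawaMainTheoremIrreducibleAuxiliaryFieldsProofs`), `d_F > 1` squarefree,
`d_F ≡ 1 (mod 4)` ("`D_F` odd": then `D_F = d_F` is the fundamental discriminant of `F = ℚ(√d_F)`).
Hypotheses (i), (iii) in Kronecker form exactly as the tree's `h521` (`(d_F/p) = −1`; for `ℓ ∣ N`:
`(d_F/ℓ) = −1`, resp. `d_F ≡ 5 (mod 8)` at `ℓ = 2`, when `p ∣ ℓ + 1`, and `(d_F/ℓ) = 1`, resp.
`d_F ≡ 1 (mod 8)`, otherwise); (ii) intrinsically ("every prime dividing `d_F` has two primes of `𝓞_K`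
above it"); (iv) for EVERY quadratic extension `M/K` containing a square root of `d_F` (all are
`K`-isomorphic to `FK`); (v) for every `F′` with `[F′ : ℚ] = 2` containing `√d_F`
(`Tian2014.IsQuadraticFieldOfSqrt`, i.e. `F′ ≅ F`) and every cyclotomic extension `L = F′(ζ_p)`
(Mathlib `IsCyclotomicExtension {p} F′ L`): `ρ̄_E|_{G_L}` irreducible; (vi) `p = 5 → d_F ≠ 5`.
Conclusions with the analytic frames ∃-quantified (existence included, as in `thm141_…` /
`thm42_XGr₂_…`; the frames pin their series).
-- TODO(general form): Cor. 4.1.4 for arbitrary weight-two newforms `g, g′` (needs `X_ord(g/K_∞)` over `𝒪_λ⟦Γ_K⟧`); drop (disc) from Cor. 4.1.4 once `L_p^Gr` has a carrier outside the §3.5 setting of [YZ26].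

## Erratum (v2, same session, 2026-08-27): the value frame
v1 of this file (p485035) typed both statements over `YanZhu2026.IsGreenbergLFunction₂`, whose
interpolation formula reads `L(f/K, ξ, 1)` as `rankinSelbergValueHecke f ξ 1` — agreement with the
Euler product on the FIXED half-plane `re s > 3/2`, sound for unitary `ξ` only; on the half `n > m` of
the type-II range the value is the junk `0` (`RankinSelbergValueHeckeVacuityProofs.lean`), so that no
series satisfies that frame (seat `bsd-littype-02`, cell INBOX 2026-08-27T01:24:27Z): over it the
`∀`-form of Cor. 4.1.4 was vacuous and the `∃`-conclusion of Prop. 5.2.1 unsatisfiable.  v2 re-targets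
both, with unchanged names (no importers existed), to the sound frame `IsGreenbergLFunctionAnyRoot₂`
(identical binder list; the prescribed value is root-independent, `typeTwoInterpolationValueL_div`).

## References
* [BurungaleCastellaSkinner2025] IMRN 2025 rnaf082 = arXiv:2405.00270v2: Cor. 4.1.4 (p. 8), Prop.
  5.2.1 (pp. 9–10) with §5 standing line (p. 9 L15–L16), Lemma 5.1.1 (`g_F`), Thm. 4.1.3.
* [YanZhu2024MainConjNonCM] J. Algebra 693 (2026) = arXiv:2412.20078v4: Thm. 4.7, Def. 3.11 (carriers).
* [BurungaleSkinnerTianWan2024] arXiv:2409.01350, §9.3.2 (the four-term sequences).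
* [CastellaGrossiSkinner2025] Math. Ann. 393 (2025): §2 (normalisation of `L_p^PR`, `L_p^Gr`).
-/

noncomputable section

open scoped Classical

open PowerSeries NumberField IsDedekindDomain Field CongruenceSubgroup
  Literature.NumberTheory.GaloisRepresentations Literature.NumberTheory.EllipticCurves
  Literature.NumberTheory.EllipticCurves.ModularForms Literature.NumberTheory.EllipticCurves.Rank1Residual
  Literature.NumberTheory.EllipticCurves.IwasawaAlgebra₂ Literature.NumberTheory.EllipticCurves.YanZhu2026

namespace Literature.NumberTheory.EllipticCurves.BurungaleCastellaSkinner2025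

/-! ## Corollary 4.1.4 (named fact) -/

/-- **Burungale–Castella–Skinner, IMRN 2025 (rnaf082) = arXiv:2405.00270v2, Corollary 4.1.4 (§4.1,
p. 8) — the two-variable equivalence for PRODUCTS of two forms.** Verbatim in the module docstring:
for newforms `g, g′`, `p ∤ 2NN′` ordinary for both, `K` imaginary quadratic with (spl),
`(D_K, NN′) = 1` and (irr_K) for both: (i) `(L_p^PR(g/K)·L_p^PR(g′/K)) ⊃ ch(X_ord(g))·ch(X_ord(g′))`
⟺ (ii) `(L_p^Gr(g/K)·L_p^Gr(g′/K)) ⊃ ch(X_Gr(g))·ch(X_Gr(g′))`, "Moreover, the same holds for the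
opposite divisibility."  TRANSCRIBED (module docstring) for the newforms of two elliptic curves
`E = W`, `E′ = W′` under `GreenbergSetting` for both (WEAKER: also (disc)) and (irr_K) for both, in the
`S = {sⁿ}` currency of `YanZhu2026.thm47_…` for every `s ≠ 0`: for every pair of type-I frames
`(F, F′)`, every Katz frame `LK` with Greenberg series `G, G′` of `f_E, f_{E′}` over it, and every
structure-compatible `J`,
`[S⁻¹ ch·ch′ ⊂ (L^PR·L^PR′)] ↔ [∃ n, J(s)ⁿ·(ch_Gr·ch_Gr′)𝒪_{ℂ_p}⟦T₁,T₂⟧ ⊆ (G·G′)]` and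
`[S⁻¹(L^PR·L^PR′) ⊂ S⁻¹ ch·ch′] ↔ [∃ n, J(s)ⁿ·(G·G′) ⊆ (ch_Gr·ch_Gr′)𝒪_{ℂ_p}⟦T₁,T₂⟧]`.
[cite: BurungaleCastellaSkinner2025, Cor. 4.1.4 (§4.1, p. 8 of arXiv:2405.00270v2) with Thm. 4.1.3 and its proof (p. 8)]
[cite: YanZhu2024MainConjNonCM, Thm. 4.7 (arXiv:2412.20078v4 TeX l.1022–1034) (the one-form case; currency)] -/
def cor414_product_ord_localised_iff_greenberg_localised : Prop :=
  ∀ {p : ℕ} [Fact p.Prime] (ι₁ : integralClosure ℚ ℂ →+* ℂ_[p]) (ι : PadicAlgCl p ≃+* ℂ)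
    (W W' : WeierstrassCurve ℚ) [W.IsElliptic] [W.IsGloballyMinimal] [W'.IsElliptic]
    [W'.IsGloballyMinimal] (K : Type) [Field K] [NumberField K] (v vbar : HeightOneSpectrum (𝓞 K))
    (κ₁ κ₂ : ZpExtension K p) (γ₁ γ₂ : absoluteGaloisGroup K)
    [Fact (ZpExtension.IsTopGeneratorPair κ₁ κ₂ γ₁ γ₂)] {N N' : ℕ} [NeZero N] [NeZero N']
    (π : ModularParametrizationData W N) (π' : ModularParametrizationData W' N')
    [NeZero (NumberField.discr K).natAbs],
    GreenbergSetting ι W N K v vbar κ₁ κ₂ → GreenbergSetting ι W' N' K v vbar κ₁ κ₂ →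
    (W.baseChange K).HasIrreducibleModPGaloisRep p → (W'.baseChange K).HasIrreducibleModPGaloisRep p →
    (∀ z : integralClosure ℚ ℂ, ι₁ z = ((ι.symm (z : ℂ) : PadicAlgCl p) : ℂ_[p])) →
    ∀ F F' : CycAntiSeries p, IsHidaRankinLFunction ι₁ W κ₁ κ₂ π.f F → IsCongruenceIntegral π.f F →
      IsHidaRankinLFunction ι₁ W' κ₁ κ₂ π'.f F' → IsCongruenceIntegral π'.f F' →
    ∀ (Ω δ : ℂ) (Ωp : (unrIntegers p)ˣ) (LK G G' : PowerSeries (PowerSeries (PadicComplexInt p))),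
      IsKatzMeasure₂ ι v vbar ∅ κ₁ κ₂ γ₁⁻¹ γ₂⁻¹ 1 Ω δ ((Ωp : unrIntegers p) : ℂ_[p]) LK →
      IsGreenbergLFunctionAnyRoot₂ ι v vbar κ₁ κ₂ γ₁⁻¹ γ₂⁻¹ π.f (NumberField.discr K).natAbs
        (NumberField.classNumber K) LK G →
      IsGreenbergLFunctionAnyRoot₂ ι v vbar κ₁ κ₂ γ₁⁻¹ γ₂⁻¹ π'.f (NumberField.discr K).natAbs
        (NumberField.classNumber K) LK G' →
    ∀ J : ℤ_[p] →+* PadicComplexInt p,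
      (∀ x : ℤ_[p], ((J x : PadicComplexInt p) : ℂ_[p]) = ((x : ℚ_[p]) : ℂ_[p])) →
    ∀ s : IwasawaAlgebra₂ p, s ≠ 0 →
      (IdealLeSpanAway s
          (WeierstrassCurve.XOrd₂.charIdeal (W.baseChange K) p κ₁ κ₂ γ₁ γ₂ *
            WeierstrassCurve.XOrd₂.charIdeal (W'.baseChange K) p κ₁ κ₂ γ₁ γ₂)
          (perrinRiouLFunction W π F * perrinRiouLFunction W' π' F') ↔
        ∃ n : ℕ, Ideal.span {toUnr₂ p J s ^ n} *
            ((WeierstrassCurve.XGr₂.charIdeal (W.baseChange K) p κ₁ κ₂ vbar γ₁ γ₂).map (toUnr₂ p J) *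
              (WeierstrassCurve.XGr₂.charIdeal (W'.baseChange K) p κ₁ κ₂ vbar γ₁ γ₂).map (toUnr₂ p J)) ≤
          Ideal.span {G * G'}) ∧
      (SpanLeIdealAway s (perrinRiouLFunction W π F * perrinRiouLFunction W' π' F')
          (WeierstrassCurve.XOrd₂.charIdeal (W.baseChange K) p κ₁ κ₂ γ₁ γ₂ *
            WeierstrassCurve.XOrd₂.charIdeal (W'.baseChange K) p κ₁ κ₂ γ₁ γ₂) ↔
        ∃ n : ℕ, Ideal.span {toUnr₂ p J s ^ n} * Ideal.span {G * G'} ≤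
          (WeierstrassCurve.XGr₂.charIdeal (W.baseChange K) p κ₁ κ₂ vbar γ₁ γ₂).map (toUnr₂ p J) *
            (WeierstrassCurve.XGr₂.charIdeal (W'.baseChange K) p κ₁ κ₂ vbar γ₁ γ₂).map (toUnr₂ p J))

/-! ## Proposition 5.2.1 (named fact) -/

/-- **Burungale–Castella–Skinner, IMRN 2025 (rnaf082) = arXiv:2405.00270v2, Proposition 5.2.1 (§5.2,
pp. 9–10) — the base-change product divisibilities.** Verbatim in the module docstring.  TRANSCRIBED
(module docstring): `E = W/ℚ` globally minimal with parametrisation `π` (`g = f_E`), `p ≥ 5`;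
`E′ = W′` a globally minimal model of the quadratic twist `W^{(d_F)}` (`∃ C, C • W′ = W.quadraticTwist d_F`;
`g_F = f_{E′}`) with parametrisation `π′`; `K` with `GreenbergSetting` for BOTH `W` and `W′` (good
ordinary `p > 2`, (spl), `(N, D_K) = (N′, D_K) = 1`, (disc)), (Heeg) for `N`, (irr_K) for `g`; `F =
ℚ(√d_F)` real quadratic through its fundamental discriminant `d_F > 1`, `d_F ≡ 1 (mod 4)` squarefree
("`D_F` odd"), with (i) `(d_F/p) = −1`, (ii) every prime dividing `d_F` split in `K`, (iii) for every
prime `ℓ ∣ N`: inert in `F` (`(d_F/ℓ) = −1`, `d_F ≡ 5 (mod 8)` if `ℓ = 2`) when `p ∣ ℓ + 1`, split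
(`(d_F/ℓ) = 1`, `d_F ≡ 1 (mod 8)`) otherwise, (iv) (irr_M) for every quadratic extension `M/K`
containing `√d_F`, (v) `ρ̄_E|_{G_{F′(ζ_p)}}` irreducible for every quadratic field `F′ ∋ √d_F` and every
cyclotomic extension `F′(ζ_p)`, (vi) `p = 5 → d_F ≠ 5`.  CONCLUSION: there are type-I frames `F₁, F₂`
of `f_E, f_{E′}` and a Katz frame `LK` with Greenberg series `G, G′` of `f_E, f_{E′}` such that
`ch(X_ord(E/K_∞))·ch(X_ord(E′/K_∞)) ⊂ (L_p^PR(E/K)·L_p^PR(E′/K))` in `Λ_K` (`IdealLeSpan`) and, along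
every structure-compatible `J`, `(ch(X_Gr(E))·ch(X_Gr(E′)))𝒪_{ℂ_p}⟦T₁,T₂⟧ ⊆ (G·G′)`.  WEAKER than
print where noted ((disc)/(N′, D_K) = 1 for the twist via the setting; frames ∃-quantified).  The
printed proof (Wan's `U(3,1)`-divisibility over `M = FK`, Hida theory for Hilbert modular forms,
Lemmas 5.1.1–5.1.2) is NOT in the tree; nothing of it is asserted beyond this statement.
-- TODO(general form): the descended display (5.3) (`h521` of `CyclotomicIwasawaMainTheoremIrreducibleAuxiliaryFieldsProofs`) follows from this fact, [CGS23, Prop. 1.2.4] (`YanZhu2026.prop37_…`), [SU14, Props. 3.6, 3.9] (`YanZhu2026.lemma53_…`) and the Galois part of Lemma 5.2.3 — assembly not in the tree.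
[cite: BurungaleCastellaSkinner2025, Prop. 5.2.1 and its proof (§5.2, pp. 9–10 of arXiv:2405.00270v2), §5 standing line (p. 9), Lemma 5.1.1 (g_F)]
[cite: YanZhu2024MainConjNonCM, Def. 3.11 and Thm. 3.3 / Def. 3.4 (the carriers, arXiv:2412.20078v4)] -/
def prop521_baseChange_product_divisibilities : Prop :=
  ∀ {p : ℕ} [Fact p.Prime] (ι₁ : integralClosure ℚ ℂ →+* ℂ_[p]) (ι : PadicAlgCl p ≃+* ℂ)
    (W W' : WeierstrassCurve ℚ) [W.IsElliptic] [W.IsGloballyMinimal] [W'.IsElliptic]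
    [W'.IsGloballyMinimal] (K : Type) [Field K] [NumberField K] (v vbar : HeightOneSpectrum (𝓞 K))
    (κ₁ κ₂ : ZpExtension K p) (γ₁ γ₂ : absoluteGaloisGroup K)
    [Fact (ZpExtension.IsTopGeneratorPair κ₁ κ₂ γ₁ γ₂)] {N N' : ℕ} [NeZero N] [NeZero N']
    (π : ModularParametrizationData W N) (π' : ModularParametrizationData W' N')
    [NeZero (NumberField.discr K).natAbs] (dF : ℤ),
    -- `p ≥ 5`; the standing data of both curves; (Heeg) and (irr_K) for `g`
    5 ≤ p → GreenbergSetting ι W N K v vbar κ₁ κ₂ → GreenbergSetting ι W' N' K v vbar κ₁ κ₂ →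
    SatisfiesHeegnerHypothesis N K → (W.baseChange K).HasIrreducibleModPGaloisRep p →
    (∀ z : integralClosure ℚ ℂ, ι₁ z = ((ι.symm (z : ℂ) : PadicAlgCl p) : ℂ_[p])) →
    -- `g_F`: `W′` is a globally minimal model of the twist of `W` by the discriminant of `F`
    (∃ C : WeierstrassCurve.VariableChange ℚ, C • W' = W.quadraticTwist (dF : ℚ)) →
    -- `F = ℚ(√d_F)` real quadratic, `D_F = d_F` odd
    1 < dF → dF % 4 = 1 → Squarefree dF →
    -- (i) `p` inert in `F`
    jacobiSym dF p = -1 →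
    -- (ii) every prime dividing `D_F` splits in `K`
    (∀ ℓ : ℕ, ℓ.Prime → (ℓ : ℤ) ∣ dF → ((Ideal.span {(ℓ : ℤ)}).primesOver (𝓞 K)).ncard = 2) →
    -- (iii) primes of `N`: inert in `F` if `ℓ ≡ −1 (mod p)`, split otherwise
    (∀ ℓ : ℕ, ℓ.Prime → ℓ ∣ W.conductorNorm ℤ →
      (p ∣ ℓ + 1 → (ℓ = 2 → dF % 8 = 5) ∧ (ℓ ≠ 2 → jacobiSym dF ℓ = -1)) ∧
      (¬ p ∣ ℓ + 1 → (ℓ = 2 → dF % 8 = 1) ∧ (ℓ ≠ 2 → jacobiSym dF ℓ = 1))) →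
    -- (iv) (irr_M) for `M = FK`
    (∀ (M : Type) [Field M] [NumberField M] [Algebra K M], Module.finrank K M = 2 →
      (∃ x : M, x ^ 2 = (dF : M)) → (W.baseChange M).HasIrreducibleModPGaloisRep p) →
    -- (v) `ρ̄_g|_{G_{F(ζ_p)}}` irreducible
    (∀ (F : Type) [Field F] [NumberField F], Tian2014.IsQuadraticFieldOfSqrt F dF →
      ∀ (L : Type) [Field L] [NumberField L] [Algebra F L], IsCyclotomicExtension {p} F L →
        (W.baseChange L).HasIrreducibleModPGaloisRep p) →
    -- (vi)
    (p = 5 → dF ≠ 5) →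
    ∃ (F₁ F₂ : CycAntiSeries p) (Ω δ : ℂ) (Ωp : (unrIntegers p)ˣ)
      (LK G G' : PowerSeries (PowerSeries (PadicComplexInt p))),
      IsHidaRankinLFunction ι₁ W κ₁ κ₂ π.f F₁ ∧ IsCongruenceIntegral π.f F₁ ∧
      IsHidaRankinLFunction ι₁ W' κ₁ κ₂ π'.f F₂ ∧ IsCongruenceIntegral π'.f F₂ ∧
      Ω ≠ 0 ∧ (δ ^ 2 = (NumberField.discr K : ℂ) ∨ δ ^ 2 = -(NumberField.discr K : ℂ)) ∧
      IsKatzMeasure₂ ι v vbar ∅ κ₁ κ₂ γ₁⁻¹ γ₂⁻¹ 1 Ω δ ((Ωp : unrIntegers p) : ℂ_[p]) LK ∧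
      IsGreenbergLFunctionAnyRoot₂ ι v vbar κ₁ κ₂ γ₁⁻¹ γ₂⁻¹ π.f (NumberField.discr K).natAbs
        (NumberField.classNumber K) LK G ∧
      IsGreenbergLFunctionAnyRoot₂ ι v vbar κ₁ κ₂ γ₁⁻¹ γ₂⁻¹ π'.f (NumberField.discr K).natAbs
        (NumberField.classNumber K) LK G' ∧
      -- `(L_p^PR(g/K)·L_p^PR(g_F/K)) ⊃ ch(X_ord(g/K_∞))·ch(X_ord(g_F/K_∞))` in `Λ_K`
      IdealLeSpan
          (WeierstrassCurve.XOrd₂.charIdeal (W.baseChange K) p κ₁ κ₂ γ₁ γ₂ *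
            WeierstrassCurve.XOrd₂.charIdeal (W'.baseChange K) p κ₁ κ₂ γ₁ γ₂)
          (perrinRiouLFunction W π F₁ * perrinRiouLFunction W' π' F₂) ∧
      -- `(L_p^Gr(g/K)·L_p^Gr(g_F/K)) ⊃ ch(X_Gr(g/K_∞))·ch(X_Gr(g_F/K_∞))` in `Λ_K^ur`
      ∀ J : ℤ_[p] →+* PadicComplexInt p,
        (∀ x : ℤ_[p], ((J x : PadicComplexInt p) : ℂ_[p]) = ((x : ℚ_[p]) : ℂ_[p])) →
        (WeierstrassCurve.XGr₂.charIdeal (W.baseChange K) p κ₁ κ₂ vbar γ₁ γ₂).map (toUnr₂ p J) *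
            (WeierstrassCurve.XGr₂.charIdeal (W'.baseChange K) p κ₁ κ₂ vbar γ₁ γ₂).map (toUnr₂ p J) ≤
          Ideal.span {G * G'}

/-! ## Proved bookkeeping -/

section Bookkeeping

variable {p : ℕ} [Fact p.Prime] {K : Type} [Field K] [NumberField K]

/-- The extended ideal of a product is the product of the extended ideals (`Ideal.map_mul` along
`toUnr₂`): the Greenberg display of Prop. 5.2.1 / Cor. 4.1.4 (ii) may be read either way.
[cite: BurungaleCastellaSkinner2025, Prop. 5.2.1 (second display, p. 10 of arXiv:2405.00270v2)] -/
theorem map_toUnr₂_mul (J : ℤ_[p] →+* PadicComplexInt p) (I I' : Ideal (IwasawaAlgebra₂ p)) :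
    (I * I').map (toUnr₂ p J) = I.map (toUnr₂ p J) * I'.map (toUnr₂ p J) :=
  Ideal.map_mul (toUnr₂ p J) I I'

/-- **Prop. 5.2.1 ⟹ the integral ORDINARY product divisibility (first display, "(5.2)")** — the input
of the printed "Proof of Theorem 1.1.2" (p. 10: "Then by Proposition 5.2.1, (5.2)").
[cite: BurungaleCastellaSkinner2025, Prop. 5.2.1 and display (5.2) (p. 10 of arXiv:2405.00270v2)] -/
theorem idealLeSpan_mul_of_prop521 (h : prop521_baseChange_product_divisibilities)
    (ι₁ : integralClosure ℚ ℂ →+* ℂ_[p]) (ι : PadicAlgCl p ≃+* ℂ) (W W' : WeierstrassCurve ℚ)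
    [W.IsElliptic] [W.IsGloballyMinimal] [W'.IsElliptic] [W'.IsGloballyMinimal]
    (v vbar : HeightOneSpectrum (𝓞 K)) (κ₁ κ₂ : ZpExtension K p) (γ₁ γ₂ : absoluteGaloisGroup K)
    [Fact (ZpExtension.IsTopGeneratorPair κ₁ κ₂ γ₁ γ₂)] {N N' : ℕ} [NeZero N] [NeZero N']
    (π : ModularParametrizationData W N) (π' : ModularParametrizationData W' N')
    [NeZero (NumberField.discr K).natAbs] {dF : ℤ} (hp : 5 ≤ p)
    (hS : GreenbergSetting ι W N K v vbar κ₁ κ₂) (hS' : GreenbergSetting ι W' N' K v vbar κ₁ κ₂)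
    (hHeeg : SatisfiesHeegnerHypothesis N K) (hirrK : (W.baseChange K).HasIrreducibleModPGaloisRep p)
    (hι : ∀ z : integralClosure ℚ ℂ, ι₁ z = ((ι.symm (z : ℂ) : PadicAlgCl p) : ℂ_[p]))
    (hW' : ∃ C : WeierstrassCurve.VariableChange ℚ, C • W' = W.quadraticTwist (dF : ℚ))
    (h1 : 1 < dF) (h4 : dF % 4 = 1) (hsq : Squarefree dF) (hi : jacobiSym dF p = -1)
    (hii : ∀ ℓ : ℕ, ℓ.Prime → (ℓ : ℤ) ∣ dF → ((Ideal.span {(ℓ : ℤ)}).primesOver (𝓞 K)).ncard = 2)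
    (hiii : ∀ ℓ : ℕ, ℓ.Prime → ℓ ∣ W.conductorNorm ℤ →
      (p ∣ ℓ + 1 → (ℓ = 2 → dF % 8 = 5) ∧ (ℓ ≠ 2 → jacobiSym dF ℓ = -1)) ∧
      (¬ p ∣ ℓ + 1 → (ℓ = 2 → dF % 8 = 1) ∧ (ℓ ≠ 2 → jacobiSym dF ℓ = 1)))
    (hiv : ∀ (M : Type) [Field M] [NumberField M] [Algebra K M], Module.finrank K M = 2 →
      (∃ x : M, x ^ 2 = (dF : M)) → (W.baseChange M).HasIrreducibleModPGaloisRep p)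
    (hv : ∀ (F : Type) [Field F] [NumberField F], Tian2014.IsQuadraticFieldOfSqrt F dF →
      ∀ (L : Type) [Field L] [NumberField L] [Algebra F L], IsCyclotomicExtension {p} F L →
        (W.baseChange L).HasIrreducibleModPGaloisRep p)
    (hvi : p = 5 → dF ≠ 5) :
    ∃ F₁ F₂ : CycAntiSeries p,
      IsHidaRankinLFunction ι₁ W κ₁ κ₂ π.f F₁ ∧ IsCongruenceIntegral π.f F₁ ∧
      IsHidaRankinLFunction ι₁ W' κ₁ κ₂ π'.f F₂ ∧ IsCongruenceIntegral π'.f F₂ ∧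
      IdealLeSpan
          (WeierstrassCurve.XOrd₂.charIdeal (W.baseChange K) p κ₁ κ₂ γ₁ γ₂ *
            WeierstrassCurve.XOrd₂.charIdeal (W'.baseChange K) p κ₁ κ₂ γ₁ γ₂)
          (perrinRiouLFunction W π F₁ * perrinRiouLFunction W' π' F₂) := by
  obtain ⟨F₁, F₂, -, -, -, -, -, -, hF₁, hc₁, hF₂, hc₂, -, -, -, -, -, hord, -⟩ :=
    h ι₁ ι W W' K v vbar κ₁ κ₂ γ₁ γ₂ π π' dF hp hS hS' hHeeg hirrK hι hW' h1 h4 hsq hi hii hiii hiv hv hvi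
  exact ⟨F₁, F₂, hF₁, hc₁, hF₂, hc₂, hord⟩

/-- **Prop. 5.2.1's ordinary display in `S`-localised form**: the integral inclusion gives the
`S = {sⁿ}`-localised one for every `s` (`IdealLeSpan.away`) — the shape consumed by Cor. 4.1.4 as
typed. [cite: BurungaleCastellaSkinner2025, Prop. 5.2.1 and its proof ("In turn Proposition 4.1.3 (and its proof) implies (5.1)", p. 10 of arXiv:2405.00270v2)] -/
theorem idealLeSpanAway_mul_of_idealLeSpan {J J' : Ideal (IwasawaAlgebra₂ p)} {L L' : CycAntiSeries p}
    (h : IdealLeSpan (J * J') (L * L')) (s : IwasawaAlgebra₂ p) : IdealLeSpanAway s (J * J') (L * L') :=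
  h.away s

/-- **The step "In turn [Cor. 4.1.4] implies (5.1)" of the proof of Prop. 5.2.1** (p. 10): granted
Cor. 4.1.4 as typed, the ordinary product divisibility for a pair of type-I frames gives, for every
Katz frame with Greenberg series `G, G′` and every compatible `J`, the Greenberg product divisibility
"before inverting `p`" (`s = 1`): `(ch_Gr·ch_Gr′)𝒪_{ℂ_p}⟦T₁,T₂⟧ ⊆ (G·G′)`.
[cite: BurungaleCastellaSkinner2025, proof of Prop. 5.2.1, display (5.1) (p. 10 of arXiv:2405.00270v2) and Cor. 4.1.4 (p. 8)] -/
theorem greenberg_mul_le_of_cor414_of_idealLeSpan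
    (h414 : cor414_product_ord_localised_iff_greenberg_localised)
    (ι₁ : integralClosure ℚ ℂ →+* ℂ_[p]) (ι : PadicAlgCl p ≃+* ℂ) (W W' : WeierstrassCurve ℚ)
    [W.IsElliptic] [W.IsGloballyMinimal] [W'.IsElliptic] [W'.IsGloballyMinimal]
    (v vbar : HeightOneSpectrum (𝓞 K)) (κ₁ κ₂ : ZpExtension K p) (γ₁ γ₂ : absoluteGaloisGroup K)
    [Fact (ZpExtension.IsTopGeneratorPair κ₁ κ₂ γ₁ γ₂)] {N N' : ℕ} [NeZero N] [NeZero N']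
    (π : ModularParametrizationData W N) (π' : ModularParametrizationData W' N')
    [NeZero (NumberField.discr K).natAbs]
    (hS : GreenbergSetting ι W N K v vbar κ₁ κ₂) (hS' : GreenbergSetting ι W' N' K v vbar κ₁ κ₂)
    (hirrK : (W.baseChange K).HasIrreducibleModPGaloisRep p)
    (hirrK' : (W'.baseChange K).HasIrreducibleModPGaloisRep p)
    (hι : ∀ z : integralClosure ℚ ℂ, ι₁ z = ((ι.symm (z : ℂ) : PadicAlgCl p) : ℂ_[p]))
    {F F' : CycAntiSeries p} (hF : IsHidaRankinLFunction ι₁ W κ₁ κ₂ π.f F)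
    (hc : IsCongruenceIntegral π.f F) (hF' : IsHidaRankinLFunction ι₁ W' κ₁ κ₂ π'.f F')
    (hc' : IsCongruenceIntegral π'.f F')
    (hord : IdealLeSpan
      (WeierstrassCurve.XOrd₂.charIdeal (W.baseChange K) p κ₁ κ₂ γ₁ γ₂ *
        WeierstrassCurve.XOrd₂.charIdeal (W'.baseChange K) p κ₁ κ₂ γ₁ γ₂)
      (perrinRiouLFunction W π F * perrinRiouLFunction W' π' F'))
    {Ω δ : ℂ} {Ωp : (unrIntegers p)ˣ} {LK G G' : PowerSeries (PowerSeries (PadicComplexInt p))}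
    (hLK : IsKatzMeasure₂ ι v vbar ∅ κ₁ κ₂ γ₁⁻¹ γ₂⁻¹ 1 Ω δ ((Ωp : unrIntegers p) : ℂ_[p]) LK)
    (hG : IsGreenbergLFunctionAnyRoot₂ ι v vbar κ₁ κ₂ γ₁⁻¹ γ₂⁻¹ π.f (NumberField.discr K).natAbs
      (NumberField.classNumber K) LK G)
    (hG' : IsGreenbergLFunctionAnyRoot₂ ι v vbar κ₁ κ₂ γ₁⁻¹ γ₂⁻¹ π'.f (NumberField.discr K).natAbs
      (NumberField.classNumber K) LK G')
    {J : ℤ_[p] →+* PadicComplexInt p}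
    (hJ : ∀ x : ℤ_[p], ((J x : PadicComplexInt p) : ℂ_[p]) = ((x : ℚ_[p]) : ℂ_[p])) :
    (WeierstrassCurve.XGr₂.charIdeal (W.baseChange K) p κ₁ κ₂ vbar γ₁ γ₂).map (toUnr₂ p J) *
        (WeierstrassCurve.XGr₂.charIdeal (W'.baseChange K) p κ₁ κ₂ vbar γ₁ γ₂).map (toUnr₂ p J) ≤
      Ideal.span {G * G'} := by
  obtain ⟨h1, -⟩ := h414 ι₁ ι W W' K v vbar κ₁ κ₂ γ₁ γ₂ π π' hS hS' hirrK hirrK' hι F F' hF hc hF' hc'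
    Ω δ Ωp LK G G' hLK hG hG' J hJ 1 one_ne_zero
  have h := h1.mp (hord.away 1)
  rw [map_one, exists_span_one_pow_mul_le_iff] at h
  exact h

end Bookkeeping

end Literature.NumberTheory.EllipticCurves.BurungaleCastellaSkinner2025

end
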